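/-
Copyright (c) 2026 the pub-hodgecm-mathlib formalisation cell (harness21).  Prover seat hodgecm-mathlib-F0P2-p01 (g15): road «S3-ram» (LEAD F0P3a-plan (g12); architect
A-p16 (g31); owner F0P3a-p06 (g15)), organ A′ (ii): J6 LABEL SIDE — the frame of a grandchild (graph ↔ matrix glue for the heads of ★ E–K); 2026-09-02.
-/
import Literature.NumberTheory.Automorphic.UnitaryLatticeTreeRankOneVertexShapeRamified         -- ★∕filed K (this seat); brings ★ J, I, H, G′, G, F, E, D and ★ `UnitaryLatticeTreeFixedStar`
import Literature.NumberTheory.Automorphic.UnitaryLatticeTreeFixedChildCountTransportRamified    -- ★ G3 (F0P2-p06 (g12)): `mem_neighborSet_latticeGraphIso_root_iff`, `latticeGraphIso_*_apply`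
import HarnessLib

/-!
# The lattice graph of a hermitian space — THE FRAME OF A GRANDCHILD: a vertex at distance two from `u·L₀` is `latt((uκ)·g(a,b))` (tame-ramified place)
# (Bruhat–Tits 1972 §10; Tits 1979 §3.5; Serre, *Trees* II.1.1)

Topic `NumberTheory/Automorphic`; namespace `Literature.NumberTheory.Automorphic.UnitaryLatticeTree`.  THEOREMS ONLY (no definition, no instance, no notation, no named fact,
no `sorry`); kernel lane `--supports stmt-HodgeConjecture-24833`.  Cell `pub/hodgecm-mathlib` (D-0151), crux H413; road «S3-ram» (Literature seeding, count-neutral), organ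
A′ (ii) of the P-1-ram skeleton (architect A-p16 (g31)); junction item J6 of the (a2) tree induction (★ engine p847302, ★ diagonal model p847449).  THE GLUE between the
GRAPH language of the engine (vertices `v`, `c`, `w` of `latticeGraph σ ϖ J₀` with `Adj v c`, `Adj c w`, `w ≠ v`) and the MATRIX∕FRAME language of the label files ★ E–K
(this seat: `Λ′ = latt(κ·g(a,b))`, `M = κ⁻¹(γ−1)κ`): **every vertex `w ≠ u·L₀` adjacent to a neighbour `c` of the self-dual vertex `u·L₀` (`u ∈ U(σ,J₀)`) is
`latt((uκ)·g(a,b))` with `c = (uκ)·N₁`, `κ ∈ K₀`, `|a| = 1`, `|b| ≤ 1`** (★ G3 `mem_neighborSet_latticeGraphIso_root_iff` for `c`; ★ D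
`exists_unit_vec_of_mem_neighborSet_N₁_of_ne_stdLattice` moved along `uκ`; ★ H `latt_coe_mul_childFrame_eq`).  With this, the J6 LABEL ROWS of the engine read, per grandchild
`w` of a fixed self-dual `v = u·L₀` with `M := (uκ)⁻¹(γ−1)(uκ)` (level `ϖ^d` ⟸ `LEV (ϖ^d) v.1` by ★ `map_sub_one_latt_le_scaleLattice_iff`, `latt(uκ) = latt u`):
`hE`∕`hO` through a null line off the kernel — ★ J `not_lev_and_not_lev₂_childLatt_of_cube_le` (child `(d−1, rank 2)`), the kernel line being the inward one (★ J §1, ★ K §4);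
`hO` through a non-null line of class `s` and `hP` — ★ H `map_sub_one_childLatt_le_scaleLattice_pred_pred` ∕ `…_pred_iff` ∕ `…_sq_…_of_le` ∕
`exists_mem_childLatt_class_neg_of_lineClass` (child `(d−2, rank ≤ 1, CLS(−s))`), the rank-one vertex's lines being all non-null of one class except the inward one (★ K);
`hR` — ★ H `not_map_sub_one_childLatt_le_scaleLattice_of_pivot` at `d = 1`; `hodd` — ★ I; counts — ★ G3⁺ p847297 ∕ J6-mult p847357 ∕ G3′ ∕ G3″ ∕ G3‴ (F0P2-p06).

* `latticeGraphIso_root_eq_of_mem_unitaryInt` (`κ ∈ K₀` fixes the root vertex), **`exists_frame_of_mem_neighborSet_neighborSet`** (the grandchild frame),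
  `exists_frame_of_adj_adj` (the same with `Adj` hypotheses).

HONEST LABEL: HC_CM is proved only modulo the 2 remaining named inputs (hLiu418 24832, h413 24833) until rung 0 closes; nothing printed is asserted here (elementary lattice
bookkeeping); «S3-ram» has no books consequence.

## References
* [BruhatTits1972] F. Bruhat, J. Tits, *Groupes réductifs sur un corps local I*, Publ. Math. IHÉS 41 (1972), §10 (lattice models; the star of a vertex).
* [Tits1979] J. Tits, *Reductive groups over local fields*, PSPM 33.1 (1979), §3.5 (reduction mod `𝔭`; ramified unitary groups).
* [Serre1980Trees] J.-P. Serre, *Trees* (1980), Ch. II §1.1 (neighbours of a lattice = lines of its reduction; frames).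
* [Kottwitz1986] R. E. Kottwitz, *Base change for unit elements of Hecke algebras*, Compositio Math. 60 (1986), §3 (shell-by-shell bookkeeping of fixed lattices).
-/

set_option autoImplicit false

noncomputable section

open scoped Valued WithZero Matrix MatrixGroups

namespace Literature.NumberTheory.Automorphic.UnitaryLatticeTree

open Literature.NumberTheory.Automorphic Literature.NumberTheory.Automorphic.HermitianLattice

variable {K : Type*} [Field K] [Valued K ℤᵐ⁰] {σ : K →+* K} {ϖ : K}

/-- `κ ∈ K₀` fixes the root vertex `L₀ = 𝒪³` of the lattice graph (★ `mapGL_stdLattice_of_mem_unitaryInt`, vertex form). [cite: BruhatTits1972, §10] [cite: Serre1980Trees, II.1.1] -/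
theorem latticeGraphIso_root_eq_of_mem_unitaryInt (hϖ : Valued.v ϖ = WithZero.exp (-1 : ℤ))
    {κ : unitaryGroupOfForm σ ((StdForm.antidiagonal 3).over K)} (hκ : κ ∈ unitaryInt σ ((StdForm.antidiagonal 3).over K)) :
    latticeGraphIso σ ϖ ((StdForm.antidiagonal 3).over K) κ ⟨stdLattice K 3, 0, isSelfDualLattice_stdLattice_three_of_v hϖ⟩ =
      ⟨stdLattice K 3, 0, isSelfDualLattice_stdLattice_three_of_v hϖ⟩ :=
  Subtype.ext (by rw [latticeGraphIso_apply_val]; exact mapGL_stdLattice_of_mem_unitaryInt hκ)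

/-- **THE FRAME OF A GRANDCHILD.**  For `u ∈ U(σ, J₀)`, a neighbour `c` of the self-dual vertex `u·L₀` and a neighbour `w ≠ u·L₀` of `c`: there are `κ ∈ K₀` and `a, b` with
`|a| = 1`, `|b| ≤ 1` such that `c = (uκ)·N₁` and `w = latt((uκ)·g(a,b))`, `g(a,b) = !![a∕ϖ,0,0; 0,1,0; b,0,ϖ]` — the configuration of the label files ★ E–K with frame `uκ`.
[cite: BruhatTits1972, §10] [cite: Serre1980Trees, II.1.1] [cite: Tits1979, §3.5] -/
theorem exists_frame_of_mem_neighborSet_neighborSet (hσ : ∀ x, σ (σ x) = x) (hvσ : ∀ a, Valued.v (σ a) = Valued.v a) (hσϖ : σ ϖ = -ϖ)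
    (hϖ : Valued.v ϖ = WithZero.exp (-1 : ℤ)) (hres : ∀ x : K, Valued.v x ≤ 1 → Valued.v (σ x - x) < 1) (h2 : Valued.v (2 : K) = 1)
    (u : unitaryGroupOfForm σ ((StdForm.antidiagonal 3).over K))
    {c w : {M : Submodule 𝒪[K] (Fin 3 → K) // IsVertex σ ϖ ((StdForm.antidiagonal 3).over K) M}}
    (hc : c ∈ (latticeGraph σ ϖ ((StdForm.antidiagonal 3).over K)).neighborSet
      (latticeGraphIso σ ϖ ((StdForm.antidiagonal 3).over K) u ⟨stdLattice K 3, 0, isSelfDualLattice_stdLattice_three_of_v hϖ⟩))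
    (hw : w ∈ (latticeGraph σ ϖ ((StdForm.antidiagonal 3).over K)).neighborSet c)
    (hne : w ≠ latticeGraphIso σ ϖ ((StdForm.antidiagonal 3).over K) u ⟨stdLattice K 3, 0, isSelfDualLattice_stdLattice_three_of_v hϖ⟩) :
    ∃ κ : unitaryGroupOfForm σ ((StdForm.antidiagonal 3).over K), κ ∈ unitaryInt σ ((StdForm.antidiagonal 3).over K) ∧ ∃ a b : K, Valued.v a = 1 ∧ Valued.v b ≤ 1 ∧
      c = latticeGraphIso σ ϖ ((StdForm.antidiagonal 3).over K) (u * κ) ⟨latt (Matrix.diagonal ![(1 : K), 1, ϖ]), 2, isVertexLattice_two_N₁_of_neg hσϖ hϖ⟩ ∧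
      w.1 = latt ((((u * κ : unitaryGroupOfForm σ ((StdForm.antidiagonal 3).over K)) : GL (Fin 3) K) : Matrix (Fin 3) (Fin 3) K) * !![a / ϖ, 0, 0; 0, 1, 0; b, 0, ϖ]) := by
  obtain ⟨κ, hκ, hcκ⟩ := (mem_neighborSet_latticeGraphIso_root_iff hσ hvσ hσϖ hϖ h2 u c).1 hc
  -- pull `w` back along `uκ`: a neighbour of `N₁` other than `L₀`
  set w' := latticeGraphIso σ ϖ ((StdForm.antidiagonal 3).over K) (u * κ)⁻¹ w with hw'def
  have hww' : latticeGraphIso σ ϖ ((StdForm.antidiagonal 3).over K) (u * κ) w' = w := latticeGraphIso_mul_inv_apply _ _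
  have hw' : w' ∈ (latticeGraph σ ϖ ((StdForm.antidiagonal 3).over K)).neighborSet ⟨latt (Matrix.diagonal ![(1 : K), 1, ϖ]), 2, isVertexLattice_two_N₁_of_neg hσϖ hϖ⟩ := by
    rw [SimpleGraph.mem_neighborSet] at hw ⊢
    rw [hcκ, ← hww'] at hw
    exact (latticeGraphIso σ ϖ ((StdForm.antidiagonal 3).over K) (u * κ)).map_adj_iff.1 hw
  have hne' : w'.1 ≠ stdLattice K 3 := by
    intro h
    apply hne
    have hroot : w' = ⟨stdLattice K 3, 0, isSelfDualLattice_stdLattice_three_of_v hϖ⟩ := Subtype.ext h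
    rw [← hww', hroot, latticeGraphIso_mul_apply, latticeGraphIso_root_eq_of_mem_unitaryInt hϖ hκ]
  obtain ⟨a, b, ha, hb, hw'1⟩ := exists_unit_vec_of_mem_neighborSet_N₁_of_ne_stdLattice hvσ hσϖ hϖ hres hw' hne'
  refine ⟨κ, hκ, a, b, ha, hb, hcκ, ?_⟩
  rw [← hww', latticeGraphIso_apply_val, hw'1, latt_coe_mul_childFrame_eq hϖ _ ha hb]

/-- **The same with `Adj` hypotheses** (`v = u·L₀`, `Adj v c`, `Adj c w`, `w ≠ v` — the shape of the engine's grandchildren `GC v` of ★ p847302 ∕ p847449).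
[cite: BruhatTits1972, §10] [cite: Serre1980Trees, II.1.1] [cite: Kottwitz1986, §3] -/
theorem exists_frame_of_adj_adj (hσ : ∀ x, σ (σ x) = x) (hvσ : ∀ a, Valued.v (σ a) = Valued.v a) (hσϖ : σ ϖ = -ϖ)
    (hϖ : Valued.v ϖ = WithZero.exp (-1 : ℤ)) (hres : ∀ x : K, Valued.v x ≤ 1 → Valued.v (σ x - x) < 1) (h2 : Valued.v (2 : K) = 1)
    (u : unitaryGroupOfForm σ ((StdForm.antidiagonal 3).over K))
    {v c w : {M : Submodule 𝒪[K] (Fin 3 → K) // IsVertex σ ϖ ((StdForm.antidiagonal 3).over K) M}}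
    (hv : v = latticeGraphIso σ ϖ ((StdForm.antidiagonal 3).over K) u ⟨stdLattice K 3, 0, isSelfDualLattice_stdLattice_three_of_v hϖ⟩)
    (hvc : (latticeGraph σ ϖ ((StdForm.antidiagonal 3).over K)).Adj v c) (hcw : (latticeGraph σ ϖ ((StdForm.antidiagonal 3).over K)).Adj c w) (hne : w ≠ v) :
    ∃ κ : unitaryGroupOfForm σ ((StdForm.antidiagonal 3).over K), κ ∈ unitaryInt σ ((StdForm.antidiagonal 3).over K) ∧ ∃ a b : K, Valued.v a = 1 ∧ Valued.v b ≤ 1 ∧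
      c = latticeGraphIso σ ϖ ((StdForm.antidiagonal 3).over K) (u * κ) ⟨latt (Matrix.diagonal ![(1 : K), 1, ϖ]), 2, isVertexLattice_two_N₁_of_neg hσϖ hϖ⟩ ∧
      w.1 = latt ((((u * κ : unitaryGroupOfForm σ ((StdForm.antidiagonal 3).over K)) : GL (Fin 3) K) : Matrix (Fin 3) (Fin 3) K) * !![a / ϖ, 0, 0; 0, 1, 0; b, 0, ϖ]) := by
  subst hv
  exact exists_frame_of_mem_neighborSet_neighborSet hσ hvσ hσϖ hϖ hres h2 u ((SimpleGraph.mem_neighborSet _ _ _).2 hvc) ((SimpleGraph.mem_neighborSet _ _ _).2 hcw) hne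

end Literature.NumberTheory.Automorphic.UnitaryLatticeTree

end
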